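import Mathlib
import HarnessLib
import HarnessLib.Audit
import Summits.QuantumFields.Statement
import Summits.QuantumFields.YangMills.Theorems.BalabanLadderIRColdPurityBridgeRungs
import Summits.QuantumFields.YangMills.Theorems.GlueballBandRecursionEffectiveBlochSymbolDefs
import Summits.QuantumFields.YangMills.Theorems.GlueballBandRecursionVolumeComparisonDefs
import HarnessLib.Audit.Status.Attr

/-!
Route: GlueballBandRecursion

# Route GlueballBandRecursion — Strong-coupling cold doubling recursion from the one-glueball band
of the torus transfer matrix (LINE onto rung ColdDoublingRecursionStrongCoupling)

X = THREE BAND BOUNDS for the excited spectrum of the `N³`-torus Wilson transfer matrix on the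
strong-coupling window `0 ≤ β ≤ strongCouplingRadius ρ`
(«it suffices to show X»): a LINE onto the EXISTING typed-open rung
`Summit.QuantumFields.YangMills.Cruxes.IR.ColdPurityBridge.ColdDoublingRecursionStrongCoupling`
(IR cell, ColdPurityBridgeRungs §5: the strong-coupling instance of obligation R «cold doubling
recursion δᶜ_β(L') ≤ C·δᶜ_β(L)²», recorded
TYPED-OPEN because the matching one-particle LOWER bound on the cold defect is not in tree). With
the canonical finite-volume rate
`q_N(β) := ⨅ₖ x_{k+2}(N)^{1/(k+2)}` (= top excited ratio λ₁/λ₀ of the `N³` transfer matrix; `x_t(N)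
= traceExcess ρ β N t`), X = K1 ∧ K2 ∧ K3:
(K3, rank 2) `OneGlueballBandLower` — `x_{⌊N/4⌋}(N) ≥ a·N^{3/2}·q_N^{⌊N/4⌋}` (a momentum BAND of
one-glueball states sits within `1/t` of the top ratio);
(K2, rank 3) `ThermalMultiplicityUpper` — `x_{⌊N/4⌋}(N) ≤ A·N³·q_N^{⌊N/4⌋}` (thermal multiplicity at
most extensive);
(K1, rank 4) `GapStableUnderRefinement` — `q_{L'} ≤ e^{D/L}·q_L` for `2L ≤ L' ≤ 4L` (finite-size
stability of the glueball mass).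
The glue (the route's `Assembly` item) is real algebra through the tree's two-sided dictionary
`2x/(1+x)² ≤ δᶜ ≤ 2x`
(`one_sub_ratio_ge_of_traceExcess`, `one_sub_ratio_le_two_mul_traceExcess`) and the tree bound
`traceExcess_le_of_strongCoupling`:
δᶜ(L') ≤ 2A·(4L)³(e^{D/L}q_L)^{⌊L'/4⌋} ≤ 128·A·e^{D}·L³·q_L^{2⌊L/4⌋} ≤ (512·A·e^{D}/a²)·δᶜ(L)².
bears_on: LADDER-YM rung R2c / IR obligation R
(crux stmt-QuantumFields-17754) in the strong-coupling window only; no summit, no mass gap at weak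
coupling, no continuum statement is proved by this line.
Lean: `Summit.QuantumFields.YangMills.Theses.GlueballBandRecursion.GapStableUnderRefinement ∧
Summit.QuantumFields.YangMills.Theses.GlueballBandRecursion.ThermalMultiplicityUpper ∧
Summit.QuantumFields.YangMills.Theses.GlueballBandRecursion.OneGlueballBandLower`

## Assembly
Pure logic: `closes (h₁ : GapStableUnderRefinement) (h₂ : ThermalMultiplicityUpper) (h₃ :
OneGlueballBandLower) (h₄ : Assembly) :
ColdDoublingRecursionStrongCoupling := h₄ h₁ h₂ h₃` (glue.lean; kernel-checked in Sketch.lean as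
`assembly_holds`). The conclusion is the typed-open RUNG by
name, not the sub-problem Statement `YangMills`: the route opens DRAFT-BY-DESIGN
(`glue.conclusion-mismatch`), like SixPlaneColdBox / HankelDensitySplitting /
SmallBetaInfraredSplit; all mathematical content of the composition is the ASSEMBLY item below
(M-sized real analysis, proved by a prover like any item: `Real.rpow`/`iInf`
bookkeeping for q_N, floor arithmetic ⌊L'/4⌋ ≥ 2⌊L/4⌋, the two dictionary lemmas and the tree
smallness bound).

Rationale: WHY THIS LINE. Open-question harvest (technique card «recent-theorem open-question harvest
2023–2026»): Faria da Veiga–O'Carroll (arXiv:2509.03513, J. Math. Phys. 67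
(2026), pp. 2, 5, 12) revisit Schor's strong-coupling glueball analysis (Schor1984, CMP 92 p. 369:
«isolated one particle states in the full
energy-momentum spectrum … mass m₀(β) ∼ −4 log β … the only spectrum up to −6(1−ε) log β», d = 3,
real irreducible character; Schor NPB 222 (1983)
doi:10.1016/0550-3213(83)90609-0) for `SU(N)`, d = 4, and prove a multiplicity-two one-glueball mass
splitting — all in the THERMODYNAMIC LIMIT
(p. 4 «free boundary conditions», p. 7 «assume we have taken the thermodynamic limit»); the finite
periodic torus with N-uniform constants, which is
exactly what the IR cell's cold-defect recursion consumes, is left open in print. The mechanism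
imported is finite-volume one-particle analysis of
polymer/cluster expansions (OsterwalderSeiler1978 §3 transfer matrix and mass gap; Munster1981
strong-coupling glueball series; KoteckyPreiss1986 cluster
expansion; BorgsImbrie1989 / BorgsKotecky1990 finite-size scaling; Luscher1986 exponentially small
finite-volume mass shifts of stable particles):
on the torus the isolated glueball becomes a translation band `E₁(p)`, `p ∈ (2π/N)ℤ³`, whose `≍
N^{3/2}` momenta within `1/t` of the bottom give K3,
whose `≤ 6·dim N³` levels give K2, and whose exponentially small N-dependence gives K1. What the
line does that the listed routes do not: the IR line
`doubling-bridge` (BalabanLadder, ym-ir idea-6) typed the rung and proved only the UPPER half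
(`coldDefect_le_of_strongCoupling`, from the tree's
sub-dominant-eigenvalue bound `transferGap_of_strongCoupling`); no route or negative speaks about
LOWER bounds on thermal multiplicities or about
the finite-size stability of λ₁/λ₀ — the negatives index near the cold defect (`¬UniformExit24`,
heavy-twist wall) concerns β-uniform EXIT claims
across the crossover, which this line never asserts (window `β ≤ strongCouplingRadius ρ` only).

RANKED CRUXES. #2 OneGlueballBandLower (crux) — For every compact G and faithful unitary lattice rep
r there are a > 0 and L₀ with: for 0 ≤ β ≤ strongCouplingRadius r.ρ, N ≥ L₀ and N/4 = m+2,
a·N^{3/2}·q_N(β)^{m+2} ≤ traceExcess r.ρ β N (m+2), where q_N(β) = ⨅ₖ (traceExcess r.ρ β N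
(k+2))^{1/(k+2)} (the one-glueball momentum band: ≍ N^{3/2} torus momenta lie within 1/t of the top
excited ratio at t = ⌊N/4⌋). [difficulty: XL] (why it might fail: The bottom of the excited torus
spectrum must be a translation band with N-,β-uniform curvature; a momentum-independent level
(torelon sector for small N·m(β), or a finite/abelian-G artefact — the rung is group-blind) below
the band with an N-uniform gap leaves O(1) states near the top.) [Schor1984, arXiv:2509.03513,
doi:10.1016/0550-3213(83)90609-0, OsterwalderSeiler1978, Munster1981]
#3 ThermalMultiplicityUpper (crux) — For every compact G and faithful unitary lattice rep r there
are A > 0 and L₀ with: for 0 ≤ β ≤ strongCouplingRadius r.ρ, N ≥ L₀ and N/4 = m+2, traceExcess r.ρ β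
N (m+2) ≤ A·N³·q_N(β)^{m+2} (the thermal multiplicity of the cold torus is at most extensive: Σᵢ
(λᵢ/λ₁)^t ≤ A·N³ at t = ⌊N/4⌋). [difficulty: L] (why it might fail: Needs Σᵢ(λᵢ/λ₁)^{N/4} ≤ A·N³
uniformly for β ↓ 0 (m(β) → ∞, constants must not blow up) and for every compact G: an accumulation
of torelon towers or multi-glueball thresholds within O(1/N) of the one-particle level for some G
would make the count super-extensive.) [Schor1984, arXiv:2509.03513, KoteckyPreiss1986,
OsterwalderSeiler1978]
#4 GapStableUnderRefinement (crux) — For every compact G and faithful unitary lattice rep r there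
are D ≥ 0 and L₀ with: for 0 ≤ β ≤ strongCouplingRadius r.ρ, L ≥ L₀ and 2L ≤ L' ≤ 4L, q_{L'}(β) ≤
exp(D/L)·q_L(β) (finite-size stability of the top excited ratio λ₁/λ₀ — the glueball mass on the
torus — under spatial refinement). [difficulty: L] (why it might fail: Requires |ln λ₁/λ₀(4L) − ln
λ₁/λ₀(L)| ≤ D/L uniformly in β ≤ r_ρ; print gives e^{−m(β)L} finite-size shifts only for an isolated
stable particle in a massive theory (Luscher1986) — a level crossing between L and 4L (torelon vs
glueball for N·σ(β) ≈ 4σ(β)) breaks the rate.) [Luscher1986, BorgsImbrie1989, BorgsKotecky1990,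
Munster1981]

TWO-LAYER PLAN. OneGlueballBandLower ⇐ (B1) a finite-torus one-particle BAND theorem: for N ≥ L₀ the
excited spectrum of the N³ transfer matrix below the
two-particle threshold is {E₁(p; N) : p ∈ (2π/N)ℤ³} × (bounded multiplicity) with |E₁(p;N) −
E₁(p;∞)| ≤ e^{−cN} and β-,N-uniform C² bounds on E₁(·;∞)
→ (B2) lattice-point count #{p : E₁(p) − min E₁ ≤ 4/N} ≥ c·N^{3/2} → OneGlueballBandLower;
ThermalMultiplicityUpper ⇐ (B1) + (U2) the rest of the
spectrum contributes ≤ N³ at t = N/4 (cluster-expansion bound on the two-particle continuum and the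
winding-flux sectors). Nothing of this is filed now.

KILL CRITERIA. A refutation of OneGlueballBandLower (e.g. an explicit compact G — finite, abelian or
SU(2) — and window point where the bottom excited level of the
N³ transfer matrix is non-degenerate with an N-uniform gap to the next N^{3/2} levels) closes the
route `refuted:OneGlueballBandLower`; a refutation of
ThermalMultiplicityUpper by a super-extensive multiplicity forces a pivot to a weighted rate
(replace q_N by the ℓ^t-mass of the band) — new route, not a
restate; GapStableUnderRefinement refuted by a level crossing ⇒ pivot to the crossing-free
sub-window β ≤ r_ρ/2 with L₀(β). The line is MOOT if the IR
cell closes obligation R (stmt-QuantumFields-17754) or the rung by another route, or if the rung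
itself is refuted (then K1 ∧ K2 ∧ K3 is refuted with it
through the proved glue — informative either way).

NOT DECOMPOSED YET. The band theorem (B1), the lattice-point count (B2), the continuum/flux-sector
bound (U2), the β ↓ 0 uniformity of all constants (m(β) → ∞ limit) and
the small-N·m(β) torelon regime are deliberately not items: they are layer-2 children once a crux is
claimed. The constants a, A, D are existential.

CHEAPEST FALSIFIER. Leading-order character expansion of the cold defect on small tori: compute
δᶜ_β(L) = 1 − Z_{L³×2t}/Z_{L³×t}², t = ⌊L/4⌋, to leading order in the
character coefficient a_r(β) for L ∈ {8, 12, 16} and two reps (SU(2) fundamental, ℤ₂), and read off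
(i) the power of L multiplying a_r^{4t} (K2/K3
predict a window between L^{3/2} and L³: thermal multiplicity = number of one-plaquette-tube
(«glueball») positions and orientations ≍ 3·L³ at
leading order, K3's N^{3/2} is the Gaussian-regime floor) and (ii) whether the ratio δᶜ(2L)/δᶜ(L)²
is L-bounded. INSTRUMENT ROW that would refute the
key lemma: pub-ymgap engine-1 `charexp` small-volume engine (character-expansion of torus partition
functions), row «coldDefect leading order, L = 8, 12, 16,
r = SU(2)-fund / ℤ₂», predicted δᶜ ≈ 2·(#tubes ≍ 3L³)·a_r(β)^{4⌊L/4⌋}(1 + O(β)); an L-exponent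
outside [3/2, 3] or an unbounded doubling ratio kills K2/K3.
Not run by me this session (the engine is the pub-ymgap cell's; by-product numerics of this seat,
kit j305784, concern the SU(3) one-link door and are
irrelevant to this line).

NUMBERS. strongCouplingRadius ρ = (e²·4·costBound ρ·(boxDeg 4 + 1)²)⁻¹ (tree,
InfiniteVolumeSufficientXII); tree upper bound traceExcess ρ β N (T+2) ≤
exp(12N³(T+2)e^{−⌊(T+2)/2⌋}) − 1 on the window (`traceExcess_le_of_strongCoupling`) and sub-dominant
ratio ≤ e^{−1/4} (`transferGap_of_strongCoupling`);
glueball mass m₀(β) ∼ −4 log β, upper gap up to −6(1−ε) log β (Schor1984 p. 369; arXiv:2509.03513 p.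
5); recursion constant delivered by the glue
C = 512·A·e^{D}/a².

DEFINITION REQUESTS. None: every item is typed over existing declarations (`traceExcess`,
`strongCouplingRadius`, `LatticeRep`, `coldDefect` via the rung decl).

Novelty: Searches (2026-08-28): `lit search --hybrid "glueball one-particle states strong coupling lattice
gauge transfer matrix"` (held: montvay1994 §3.6, OS78,
arXiv:2509.03513); `lit search "Schor glueball spectroscopy strongly coupled" --source all` (Schor
CMP 92 / NPB 222 / NPB 231); `lit search "lattice Yang-Mills
strong coupling exponential decay" --year-from 2022` (CNS arXiv:2509.04688, 2510.22788, 2505.16585 —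
no finite-torus spectral statements); `lit galaxy search
"spectroscopy in strongly coupled lattice|Existence of glueballs|one-particle states in lattice"
--star all` (1 hit: [galaxy:pdf:6740957488839261540] =
Schor CMP 92 (1984), read p. 369); `lit galaxy search "glueball|one-particle states|upper gap"
--star all` (28 rows, all noise); tree: `rg ColdDoublingRecursionStrongCoupling`
(only the bridge files + ym-ir notes), `lean search traceExcess` (no lower-bound lemma beyond
`le_traceExcess`-type positivity), `ledger negatives --problem
QuantumFields` (5 refuted rows, none on thermal multiplicities).
Nearest prior art found: [corpus:paper:arxiv-2509.03513 p.5, p.12] Faria da Veiga–O'Carroll 2026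
(one-glueball states and multiplicity-two mass splitting,
SU(N), d = 4, thermodynamic limit) and [galaxy:pdf:6740957488839261540 p.369] Schor1984 (isolated
one-particle states, d = 3, infinite volume); in tree the
IR line doubling-bridge §5 (upper half of the rung only).
Delta: the finite periodic torus with N-uniform constants — band multiplicity floor N^{3/2},
extensive ceiling  [refs: 2509.03513, 2509.04688, paper:arxiv-2509.03513, Schor1984]

Barriers (technique_class: strong-coupling-expansion, transfer-matrix-spectral): - technique_class: strong-coupling-expansion, transfer-matrix-spectral
- Literature.Barriers.QuantumFields.AbelianDeconfinementD4: outside — Guth / Fröhlich–Spencer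
deconfinement of U(1)₄ is a WEAK-coupling fact and the barrier kills group-blind confinement claims
reaching large β; every crux here lives on β ≤ strongCouplingRadius ρ (inside the convergent OS78
cluster expansion, where U(1)₄ is itself massive and confining), asserts spectral multiplicity
bounds — not an area law — and nothing is extrapolated in β.
- Literature.Barriers.QuantumFields.MigdalKadanoffGroupBlindness: outside — the barrier kills
group-blind CONFINEMENT-AT-ALL-β arguments by the U(1)₄ test; this line is confined to β ≤
strongCouplingRadius ρ, where the OS78 cluster expansion is legitimately group-blind (U(1)₄ is
massive there too), and claims nothing at weak coupling.
- Literature.Barriers.QuantumFields.FiniteTemperatureDeconfinement: outside — Borgs–Seiler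
deconfinement is at fixed temporal extent and large β; here t = ⌊N/4⌋ → ∞ with N and β ≤ r_ρ (the
cold regime of the bridge), and the cruxes are statements about ratios λᵢ/λ₀ of the spatial transfer
matrix, not about Polyakov-loop order.
- Literature.Barriers.QuantumFields.ToronPlaneAnticorrelation: priced, not evaded — the thermal
trace includes the twisted/winding-flux (toron) sectors; K2/K3 need the torelon levels (energy ≍
N·σ(β)) to lie above the glueball band (≍ 4σ(β)) for N ≥ L₀, which is where L₀ is spent; no
correlation-inequality (Griffi

History (route lifecycle, newest last):
- 2026-08-28T11:07:32Z · rev 2: informal re-worded for ThermalMultiplicityUpper (planner-ym-idea-2-g5-0)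

sub-problem: YangMills · status: draft · opened planner-ym-idea-2-g5-0 2026-08-28T10:43:16Z · rev 5 · ledger route-QuantumFields-GlueballBandRecursion
GENERATED by the gate from the ledger (D-0016/17). Provers cite these decls: `theorem foo : Summit.QuantumFields.YangMills.Theses.GlueballBandRecursion.<Decl> := …` in Summits/QuantumFields/YangMills/Theorems/<Name>.lean.
-/

namespace Summit.QuantumFields.YangMills.Theses.GlueballBandRecursion

open scoped BigOperators Topology Manifold Classical MeasureTheory ProbabilityTheory Matrix InnerProductSpace ComplexConjugate ContinuousMap
open Filter Set Function TopologicalSpace MeasureTheory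

attribute [summit_statement] _root_.YangMills

/-- item stmt-QuantumFields-22957 · crux · rank 2 · open · by planner
[crux] P1 — THE ONE LOAD-BEARING OBJECT of the line (critic idea-crit-4 N1 2026-08-28T17:14Z; LEAD
ym-line-cbag-p1 g23/g25 consolidation): the effective one-particle Bloch symbol family of the
strong-coupling N³-torus Wilson transfer matrix (def Band.EffectiveBlochSymbolFamily,
Theorems/GlueballBandRecursionEffectiveBlochSymbolDefs.lean): per (G,r) β-uniform constants; per β
either q_N = 0 eventually or a periodic Hermitian symbol with log-C² Rayleigh quotients,
volume-stable sup |log Λ − ℓ| ≤ D′/N, and two-sided control of the cold thermal trace excess by its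
Bloch blocks at large times and at t = ⌊N/4⌋. It implies ALL THREE cruxes by landed theorems
(Band.oneGlueballBandDichotomy_/thermalMultiplicityUpper_/gapStableUnderRefinement_of_effectiveBlochSymbolFamily,
RungOfBlochSymbol.lean) and is the registered stub stub_effectiveBlochSymbolFamily on
27554/27507/27508 — staff ONE crew here. Difficulty XL: a β-uniform finite-torus one-glueball band
theorem = Schor 1983/84 / Borgs–Imbrie-type cluster expansion of the transfer matrix on the PERIODIC
torus, not in print. Why it might fail: the one-glueball level may fail to be band-isolated
uniformly on the window for some compact G (tore -/
@[route_item "route-QuantumFields-GlueballBandRecursion"]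
def OneParticleBlochSymbolFamily : Prop :=
  Summit.QuantumFields.YangMills.Theorems.GlueballBandRecursion.Band.EffectiveBlochSymbolFamily

/-- item stmt-QuantumFields-27554 · crux · rank 2 · open · by planner
why it might fail: All three cruxes hinge on ONE object, Band.EffectiveBlochSymbolFamily: a β-uniform one-glueball Bloch band of the strong-coupling torus transfer matrix; needs a Schor/Borgs–Imbrie cluster expansion on the PERIODIC torus, not in print; fails if the band is not isolated for some G.
sources: Schor1984, BorgsImbrie1989, arXiv:2509.03513, galaxy:pdf:6740957488839261540
[crux] BAND-OR-ISOLATED dichotomy (rev 1, pays critic idea-crit-4 P1 10:49:26Z): for every compact G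
and faithful r there are a, A' > 0 and L₀ such that for every β on the strong-coupling window 0 ≤ β
≤ strongCouplingRadius ρ EITHER the one-glueball band floor a·N^{3/2}·q_N^t ≤ x_t(N) holds for all N
≥ L₀ (t = ⌊N/4⌋ ≥ 2, q_N = ⨅ₖ x_{k+2}(N)^{1/(k+2)} = λ₁/λ₀; generic case: analytic band with
quadratic-or-flatter bottom, Schor 1983/84) OR the bottom excited level is thermally isolated,
x_t(N) ≤ A'·q_N^t for all N ≥ L₀ (the finite/abelian scenario of P1). Either branch closes the rung
(branch 1: C = 512Ae^D/a², the proved Assembly algebra; branch 2: δᶜ(L') ≤ 2A'e^D q_L^{2t} ≤ 8A'e^D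
δᶜ(L)²). Constants a, A' depend on (G, r) only, NOT on β (take a at the worst β of the compact
window; flat bands help the floor). Why it might fail: an intermediate multiplicity growth N^α, 0 <
α < 3/2, at the bottom of the excited spectrum uniformly in N (needs a non-analytic dispersion
|p|^s, 1 ≤ s < 2, or a torelon-dominated bottom for N ≥ L₀ — excluded in print only in infinite
volume); the ∨ is per β but uniform in N, so an N-dependent crossover band↔isolated beyond L₀ also
breaks it. Instrument wor -/
@[route_item "route-QuantumFields-GlueballBandRecursion", crux]
def OneGlueballBandDichotomy : Prop :=
  ∀ (G : Type) [Group G] [TopologicalSpace G] [IsTopologicalGroup G] [CompactSpace G], letI : MeasurableSpace G := borel G; haveI : BorelSpace G := ⟨rfl⟩; ∀ r : Literature.MathematicalPhysics.QuantumFieldTheory.LatticeRep G, ∃ a : ℝ, 0 < a ∧ ∃ A' : ℝ, 0 < A' ∧ ∃ L₀ : ℕ, ∀ β : ℝ, 0 ≤ β → β ≤ Literature.MathematicalPhysics.QuantumFieldTheory.Balaban1983to89.Missing.strongCouplingRadius r.ρ → (∀ (N : ℕ) [NeZero N] (m : ℕ), N / 4 = m + 2 → L₀ ≤ N → a * Real.sqrt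 (N : ℝ) ^ 3 * (⨅ k : ℕ, Literature.MathematicalPhysics.QuantumFieldTheory.traceExcess r.ρ β N (k + 2) ^ ((1 : ℝ) / ((k : ℝ) + 2))) ^ (m + 2) ≤ Literature.MathematicalPhysics.QuantumFieldTheory.traceExcess r.ρ β N (m + 2)) ∨ (∀ (N : ℕ) [NeZero N] (m : ℕ), N / 4 = m + 2 → L₀ ≤ N → Literature.MathematicalPhysics.QuantumFieldTheory.traceExcess r.ρ β N (m + 2) ≤ A' * (⨅ k : ℕ, Literature.MathematicalPhysics.QuantumFieldTheory.traceExcess r.ρ β N (k + 2) ^ ((1 : ℝ) / ((k : ℝ) + 2))) ^ (m + 2))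

/-- item stmt-QuantumFields-27507 · crux · rank 3 · open · by planner
why it might fail: ⇐ Band.EffectiveBlochSymbolFamily via thermalMultiplicityUpper_of_effectiveBlochSymbolFamily (landed); same XL object as 27554. Fails if torelon towers or multi-glueball thresholds accumulate within O(1/N) of the one-particle level for some G (super-extensive count as β ↓ 0).
sources: Schor1984, arXiv:2509.03513, KoteckyPreiss1986, OsterwalderSeiler1978
[crux] For every compact G and faithful unitary lattice rep r there are A > 0 and L₀ with: for 0 ≤ β
≤ strongCouplingRadius r.ρ, N ≥ L₀ and N/4 = m+2, traceExcess r.ρ β N (m+2) ≤ A·N³·q_N(β)^{m+2} (the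
thermal multiplicity of the cold torus is at most extensive: Σᵢ (λᵢ/λ₁)^t ≤ A·N³ at t = ⌊N/4⌋).
CONSTANTS (critic P2, 10:49:26Z): A and L₀ depend on (G, r) only and are β-UNIFORM on the compact
window [0, strongCouplingRadius ρ]. L₀ CHOICE: L₀(G,r) > sup_{β ≤ ρ} m(β)/σ(β) (≈ 4 at strong
coupling, m ≈ −4·log a_r(β), σ ≈ −log a_r(β)), so that the TORELON sector (spatially winding
electric-flux states, E_tor(β,N) ≈ σ(β)·N) lies strictly above the one-glueball level for every N ≥
L₀; the tree's torus transfer-matrix state space (gauge-invariant slice functions,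
Literature/…/WilsonTransferKernel.lean) DOES contain the winding sectors (spatial Polyakov loops),
so the torelon towers are part of traceExcess and are disposed of here, not assumed away: their
weight ≤ 3N²·e^{−(σN−m)·t} relative to q_N^t, summable into A for N ≥ L₀. Multi-glueball thresholds:
the k-particle continuum contributes ≲ N^{3k}·q_N^{k·t(1−o(1))} ≤ A_k·N³·q_N^t since
N³·e^{−m_min·N/4} is bounded (m(β) ≥ m_min > 0 on the -/
@[route_item "route-QuantumFields-GlueballBandRecursion", crux]
def ThermalMultiplicityUpper : Prop :=
  ∀ (G : Type) [Group G] [TopologicalSpace G] [IsTopologicalGroup G] [CompactSpace G], letI : MeasurableSpace G := borel G; haveI : BorelSpace G := ⟨rfl⟩; ∀ r : Literature.MathematicalPhysics.QuantumFieldTheory.LatticeRep G, ∃ A : ℝ, 0 < A ∧ ∃ L₀ : ℕ, ∀ β : ℝ, 0 ≤ β → β ≤ Literature.MathematicalPhysics.QuantumFieldTheory.Balaban1983to89.Missing.strongCouplingRadius r.ρ → ∀ (N : ℕ) [NeZero N] (m : ℕ), N / 4 = m + 2 → L₀ ≤ N → Literature.MathematicalPhysics.QuantumFieldTheory.traceExcess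 r.ρ β N (m + 2) ≤ A * (N : ℝ) ^ 3 * (⨅ k : ℕ, Literature.MathematicalPhysics.QuantumFieldTheory.traceExcess r.ρ β N (k + 2) ^ ((1 : ℝ) / ((k : ℝ) + 2))) ^ (m + 2)

/-- item stmt-QuantumFields-27508 · crux · rank 4 · open · by planner
why it might fail: ⇐ Band.EffectiveBlochSymbolFamily via gapStableUnderRefinement_of_effectiveBlochSymbolFamily (landed); same XL object as 27554. Fails on a level crossing (torelon vs glueball) between L and 4L: print gives e^{−mL} shifts only for an isolated stable particle (Luscher1986).
sources: Luscher1986, BorgsImbrie1989, BorgsKotecky1990, Munster1981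
[crux] For every compact G and faithful unitary lattice rep r there are D ≥ 0 and L₀ with: for 0 ≤ β
≤ strongCouplingRadius r.ρ, L ≥ L₀ and 2L ≤ L' ≤ 4L, q_{L'}(β) ≤ exp(D/L)·q_L(β) (finite-size
stability of the top excited ratio λ₁/λ₀ — the glueball mass on the torus — under spatial
refinement). [difficulty: L] -/
@[route_item "route-QuantumFields-GlueballBandRecursion", crux]
def GapStableUnderRefinement : Prop :=
  ∀ (G : Type) [Group G] [TopologicalSpace G] [IsTopologicalGroup G] [CompactSpace G], letI : MeasurableSpace G := borel G; haveI : BorelSpace G := ⟨rfl⟩; ∀ r : Literature.MathematicalPhysics.QuantumFieldTheory.LatticeRep G, ∃ D : ℝ, 0 ≤ D ∧ ∃ L₀ : ℕ, ∀ β : ℝ, 0 ≤ β → β ≤ Literature.MathematicalPhysics.QuantumFieldTheory.Balaban1983to89.Missing.strongCouplingRadius r.ρ → ∀ (L : ℕ) [NeZero L] (L' : ℕ) [NeZero L'], L₀ ≤ L → 2 * L ≤ L' → L' ≤ 4 * L → (⨅ k : ℕ, Literature.MathematicalPhysics.QuantumFieldTheory.traceExcess r.ρ β L' (k + 2) ^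 ((1 : ℝ) / ((k : ℝ) + 2))) ≤ Real.exp (D / (L : ℝ)) * (⨅ k : ℕ, Literature.MathematicalPhysics.QuantumFieldTheory.traceExcess r.ρ β L (k + 2) ^ ((1 : ℝ) / ((k : ℝ) + 2)))

/-- item stmt-QuantumFields-27506 · aside · rank 2 · open · by planner
why it might fail: The bottom of the excited torus spectrum must be a translation band with N-,β-uniform curvature; a momentum-independent level (torelon sector for small N·m(β), or a finite/abelian-G artefact — the rung is group-blind) below the band with an N-uniform gap leaves O(1) states near the top.
sources: Schor1984, arXiv:2509.03513, doi:10.1016/0550-3213(83)90609-0, OsterwalderSeiler1978, Munster1981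
[crux] For every compact G and faithful unitary lattice rep r there are a > 0 and L₀ with: for 0 ≤ β
≤ strongCouplingRadius r.ρ, N ≥ L₀ and N/4 = m+2, a·N^{3/2}·q_N(β)^{m+2} ≤ traceExcess r.ρ β N
(m+2), where q_N(β) = ⨅ₖ (traceExcess r.ρ β N (k+2))^{1/(k+2)} (the one-glueball momentum band: ≍
N^{3/2} torus momenta lie within 1/t of the top excited ratio at t = ⌊N/4⌋). [difficulty: XL] -/
@[route_item "route-QuantumFields-GlueballBandRecursion", crux]
def OneGlueballBandLower : Prop :=
  ∀ (G : Type) [Group G] [TopologicalSpace G] [IsTopologicalGroup G] [CompactSpace G], letI : MeasurableSpace G := borel G; haveI : BorelSpace G := ⟨rfl⟩; ∀ r : Literature.MathematicalPhysics.QuantumFieldTheory.LatticeRep G, ∃ a : ℝ, 0 < a ∧ ∃ L₀ : ℕ, ∀ β : ℝ, 0 ≤ β → β ≤ Literature.MathematicalPhysics.QuantumFieldTheory.Balaban1983to89.Missing.strongCouplingRadius r.ρ → ∀ (N : ℕ) [NeZero N] (m : ℕ), N / 4 = m + 2 → L₀ ≤ N → a * Real.sqrt (N : ℝ) ^ 3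 * (⨅ k : ℕ, Literature.MathematicalPhysics.QuantumFieldTheory.traceExcess r.ρ β N (k + 2) ^ ((1 : ℝ) / ((k : ℝ) + 2))) ^ (m + 2) ≤ Literature.MathematicalPhysics.QuantumFieldTheory.traceExcess r.ρ β N (m + 2)

/-- item stmt-QuantumFields-23425 · aside · rank 9 · open · by planner
[aside] LINE 7b (volume comparison; LEAD ym-line-cbag-p1 g29 + width seats w2-w5; critic idea-crit-4
VERDICT PASS 2026-08-28T20:12:52Z) typed-window statement VC, by name = tree decl
Theorems.GlueballBandRecursion.TraceExcessVolumeComparison (p663216): spatial extensivity of the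
cold trace excess at FIXED time across volumes, x_{m+2}(L') <= K x_{m+2}(L) for L/4 = m+2, L >= L0,
2L <= L' <= 4L, on the whole window 0 <= beta <= strongCouplingRadius r.rho, every compact G and
faithful unitary r. SECOND WAY to this route's closes target besides the band (items
22957/27554/27507/27508): kernel edge coldDoublingRecursionStrongCoupling_of_volumeComparison : VC
-> Cruxes.IR.ColdPurityBridge.ColdDoublingRecursionStrongCoupling (p663651, C = 8K^2+1;
antitone-in-time + same-volume squaring x_{2t} <= x_t^2 + coldDefect within factor 2 of
traceExcess). Booked ASIDE (banked, not staffed; closes of record unchanged) pending director-ym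
crew-or-park. RESIDUAL versus the exists-window theorem (item ColdDoublingSmallWindow) = WINDOW
CERTIFICATION on [beta1, r_rho]: the jets + Schwarz tail 48t(beta/(e r_rho))^{4(a-1)} beats the
floor (c1 beta^4)^t only for beta <~ c1^{1/12}(e r_rho)^{4/3} << r_rho; th -/
@[route_item "route-QuantumFields-GlueballBandRecursion"]
def VolumeComparisonTyped : Prop :=
  Summit.QuantumFields.YangMills.Theorems.GlueballBandRecursion.TraceExcessVolumeComparison

/-- item stmt-QuantumFields-23426 · aside · rank 9 · closed · proved by Summit.QuantumFields.YangMills.Theorems.GlueballBandRecursion.coldDoublingSmallWindow_proof (prover) · by planner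
[aside] LINE 7b deliverable of record: the EXISTS-WINDOW strong-coupling cold doubling recursion, by
name = tree decl Theorems.GlueballBandRecursion.ColdDoublingRecursionSmallCoupling (p663216): for
every compact G and faithful unitary r there are beta1 > 0, C > 0, L0 with coldDefect r.rho beta L'
<= C (coldDefect r.rho beta L)^2 for 0 <= beta <= beta1, L >= L0, 2L <= L' <= 4L. Reached in tree by
the kernel edges Thermal.coldDoublingRecursionSmallCoupling_of_coldJets : ColdFreeEnergyVolumeJets
-> TraceExcessFloorAllSides -> this (p666566, K = 520), Thermal.traceExcessFloorAllSides_holds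
(p664979, width seat w5) and coldDoublingRecursionSmallCoupling_of_keptDensity (kept-density lifting
identity -> this; Theorems/GlueballBandRecursionColdFreeEnergyJets.lean, LEAD g29), the lifting
identity being landed by the width seats (SupportLifting / ClosedRootingUnique / SupportInclusion);
when Thermal-side theorem coldDoublingRecursionSmallCoupling_holds lands, a one-line theorem
ColdDoublingSmallWindow_holds by name closes this item. Banked record (ASIDE): it does NOT imply the
closes target ColdDoublingRecursionStrongCoupling (typed window [0, strongCouplingRadius]); only the
converse edge -/
@[route_item "route-QuantumFields-GlueballBandRecursion"]
def ColdDoublingSmallWindow : Prop :=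
  Summit.QuantumFields.YangMills.Theorems.GlueballBandRecursion.ColdDoublingRecursionSmallCoupling

-- `ColdDoublingSmallWindow` holds: proved by `Summit.QuantumFields.YangMills.Theorems.GlueballBandRecursion.coldDoublingSmallWindow_proof` (its module imports this route file, so no `_holds` link can be stated here).

/-- item stmt-QuantumFields-27509 · assembly · rank 1 · closed · proved by Summit.QuantumFields.YangMills.Theorems.GlueballBandRecursion.assembly_proof (prover) · by planner
sources: OsterwalderSeiler1978, Seiler1978
[assembly] Glue (real algebra over the tree dictionary, the route's ASSEMBLY item):
GapStableUnderRefinement → ThermalMultiplicityUpper → OneGlueballBandLower →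
ColdDoublingRecursionStrongCoupling, via δᶜ(L') ≤ 2x_{⌊L'/4⌋}(L')
(one_sub_ratio_le_two_mul_traceExcess) ≤ 2A(4L)³(e^{D/L}q_L)^{⌊L'/4⌋} ≤ 128Ae^{D}L³q_L^{2⌊L/4⌋}
(⌊L'/4⌋ ≥ 2⌊L/4⌋, ⌊L'/4⌋ ≤ L, 0 ≤ q_L ≤ 1) and δᶜ(L) ≥ 2x/(1+x)² ≥ x/2
(one_sub_ratio_ge_of_traceExcess, x ≤ 1 from traceExcess_le_of_strongCoupling for L ≥ L₀) ≥
(a/2)L^{3/2}q_L^{⌊L/4⌋}, hence δᶜ(L') ≤ (512Ae^{D}/a²)·δᶜ(L)². -/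
@[route_item "route-QuantumFields-GlueballBandRecursion"]
def Assembly : Prop :=
  Summit.QuantumFields.YangMills.Theses.GlueballBandRecursion.GapStableUnderRefinement → Summit.QuantumFields.YangMills.Theses.GlueballBandRecursion.ThermalMultiplicityUpper → Summit.QuantumFields.YangMills.Theses.GlueballBandRecursion.OneGlueballBandLower → Summit.QuantumFields.YangMills.Cruxes.IR.ColdPurityBridge.ColdDoublingRecursionStrongCoupling

-- `Assembly` holds: proved by `Summit.QuantumFields.YangMills.Theorems.GlueballBandRecursion.assembly_proof` (its module imports this route file, so no `_holds` link can be stated here).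

/-- item stmt-QuantumFields-27555 · assembly · rank 9 · closed · proved by Summit.QuantumFields.YangMills.Theorems.GlueballBandRecursion.assembly2_proof (prover) · by planner
[support] Glue rev 1 (M, provable now): GapStableUnderRefinement → ThermalMultiplicityUpper →
OneGlueballBandDichotomy → ColdDoublingRecursionStrongCoupling. Per (G, r): constants D (K1), A
(K2), a, A' (K3′), L₀'s; for β on the window and L ≥ L₀ := max(L₀'s, L₁, 8), 2L ≤ L' ≤ 4L, t =
⌊L/4⌋, t' = ⌊L'/4⌋ (2t ≤ t' ≤ L): branch 1 (band at this β) is verbatim the proved Assembly algebra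
of Theorems/GlueballBandRecursionAssembly.lean (assembly_proof; helper lemmas traceExcess_nonneg,
rate_nonneg, rate_le_rpow, traceExcess_le_one_of_large there): δᶜ(L') ≤ 128A e^D L³ q_L^{2t}, δᶜ(L)²
≥ (a²/4) L³ q_L^{2t} ⇒ C₁ = 512Ae^D/a²; branch 2 (isolated at this β): δᶜ(L') ≤ 2x_{t'}(L') ≤ 2A'
q_{L'}^{t'} ≤ 2A' e^{D t'/L} q_L^{t'} ≤ 2A'e^D q_L^{2t} and δᶜ(L) ≥ 2x/(1+x)² ≥ x/2 ≥ q_L^t/2 (x_t ≥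
q^t from rate_le_rpow: q ≤ x_t^{1/t}) ⇒ C₂ = 8A'e^D; take C = max(C₁, C₂) before β. Sources:
OsterwalderSeiler1978, Seiler1982 (dictionary); adapts Theorems/GlueballBandRecursionAssembly.lean.
[difficulty: M] -/
@[route_item "route-QuantumFields-GlueballBandRecursion", crux]
def Assembly2 : Prop :=
  Summit.QuantumFields.YangMills.Theses.GlueballBandRecursion.GapStableUnderRefinement → Summit.QuantumFields.YangMills.Theses.GlueballBandRecursion.ThermalMultiplicityUpper → Summit.QuantumFields.YangMills.Theses.GlueballBandRecursion.OneGlueballBandDichotomy → Summit.QuantumFields.YangMills.Cruxes.IR.ColdPurityBridge.ColdDoublingRecursionStrongCoupling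

-- `Assembly2` holds: proved by `Summit.QuantumFields.YangMills.Theorems.GlueballBandRecursion.assembly2_proof` (its module imports this route file, so no `_holds` link can be stated here).

/-! D-0027 §2.1 — DECIDING THEOREM (planner-authored via `route open/edit --closes-file`; by planner-ym-idea-2-g5-0 2026-08-28T11:07:32Z):
its hypotheses are this route's items and its conclusion the sub-problem Statement (glue_lint), and it elaborates with this file. -/

@[closes "route-QuantumFields-GlueballBandRecursion"] theorem closes (h₁ : GapStableUnderRefinement) (h₂ : ThermalMultiplicityUpper) (h₃ : OneGlueballBandDichotomy)
    (h₄ : Assembly2) :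
    Summit.QuantumFields.YangMills.Cruxes.IR.ColdPurityBridge.ColdDoublingRecursionStrongCoupling :=
  h₄ h₁ h₂ h₃

end Summit.QuantumFields.YangMills.Theses.GlueballBandRecursion
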